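import Mathlib
import Literature.MathematicalPhysics.QuantumFieldTheory.Balaban1983to89.B12PlaquetteLoop267
import Literature.MathematicalPhysics.QuantumFieldTheory.Balaban1983to89.BlockAveragingFederbush

/-!
# [Balaban1987RG1] p. 252 `𝐆(y,x)`, p. 253 (0.10)–(0.11) `𝐔(y,x) = M({U(Γ)}_{Γ ∈ 𝐆(y,x)})`: the averaged contour
# variables of Bałaban's block averaging on the `ℤᵈ` corner-cube geometry of the b12 lineage, their SMALL DIAMETER
# under plaquette regularity, and the (0.12) instance of the `h`-paragraph of p. 267

Cell `pub-balaban`, paper sub-cell B12, lineage b12 (one-writer leaves `B12HOperator267` → `B12HOperatorNeumann267` →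
`B12AverageCorridor267` → `B12PlaquetteLoop267` → this file), gen 23.  ADDITIVE LEAF: imports `B12PlaquetteLoop267`
and `BlockAveragingFederbush` only, modifies nothing, is imported by nothing.

WHAT IS QUOTED (rendered pages of T. Bałaban, *Renormalization group approach to lattice gauge field theories. I.
Generation of effective actions in a small field approximation and a coupling constant renormalization in four
dimensions*, Commun. Math. Phys. **109** (1987) 249–301 [Balaban1987RG1]; cell renders
`b2b-balaban-ref1/pages/1987-cmp109-rg-I-small-field/…-p004/p005/p006`).  Page 252: «For a point x ∈ B(y) we take
a family 𝐆(y, x) of shortest contours with the initial point at y, and the final point at x. If x − y = Σ_{μ=1}^d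
δn_μe_μ (δ is a lattice spacing, n_μ an integer such that |n_μ| ≦ L−1/2), then we construct contours of 𝐆(y, x) in
the following way: take a permutation {π(1), π(2), …} of indices μ with nonzero numbers n_μ, next take |n_{π(1)}|
bonds in the direction sign n_{π(1)}e_{π(1)} starting at y, |n_{π(2)}| bonds in the direction sign n_{π(2)}e_{π(2)}
starting at y + δn_{π(1)}e_{π(1)}, and so on. We define 𝐆(y, x) as the family of contours generated by all such
permuations.»  Page 253: «We need also a Euclidean invariant definition of the axial gauge fixing. A natural idea, in
agreement with the above definition, would be to use variables obtained by averaging the contour variables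
{𝐔(Γ)}_{Γ∈𝐆(y,x)}, rather than to use one contour variable 𝐔(Γ_{y,x}). Thus we have to define an average of a finite
set of group elements. We introduce an axiomatric definition of such an average. It is a Gᶜ-valued function defined
on sets {𝐔_j : j = 1, 2, …, n}, 𝐔_j ∈ Gᶜ, with sufficiently small diameters.» … «M({u𝐔_jv}) = uM({𝐔_j})v; (0.6)
M(π{𝐔_j}) = M({𝐔_j}) for an arbitrary permutation π of the set {𝐔_j}; (0.7)» … «Let us write a definition which is
equivalent to the one given by Federbush in [35]. The average of the set {𝐔_j} is the element 𝐔 ∈ Gᶜ such that 𝐔_j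
are in a small neighborhood of 𝐔, and it satisfies the equation Σ_{j=1}^n (1/i) log 𝐔_j𝐔⁻¹ = 0. (0.10) This
definition has all the properties listed above, as it was proved by Federbush in [35 (II)].» … «Having such an
average we introduce the averaged contour variable corresponding to the set of contours 𝐆(y, x),
𝐔(y, x) = M({𝐔(Γ)}_{Γ∈𝐆(y,x)}). (0.11) In fact the only reason for introducing the group averages with the
properties (0.5)–(0.10) is to define the controur variables (0.11) which are invariant with respect to permutations
of the contours Γ in 𝐆(x, y).»  Page 254, (0.12): «Ū(c) = exp[i Σ_{x∈B(c₋)} L⁻ᵈ (1/i) log 𝐔(c₋, x)𝐔([x, x′])𝐔(x′, c₊)𝐔(−c)] 𝐔(c).»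
and «|U(∂p) − 1| < ε₀ for p ∈ T, with ε₀ positive and sufficiently small».  Page 267 (the `h`-paragraph) is quoted in
`B12HOperator267`.  WHAT IS REPRODUCED: nothing of the paper is asserted; every theorem below is [folklore]
bookkeeping and elementary normed-ring estimates over the tree's typed objects; the `[cite:]` tags mark TEXT
LOCATIONS of the objects typed, not imported facts.  No hypothesis names a result of the series; no `sorry`, no
`axiom`.  NOT summit progress: fine lattice `ℤᵈ`, one renormalization step's averaging combinatorics, nothing about
effective actions, the continuum or the Clay problem.

WHAT THIS FILE DEFINES AND PROVES (all constants the cell's, not print's).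

§ 1  THE CONTOUR FAMILY `𝐆(q, x)` AS FORWARD LATTICE WORDS of the tree's [B7]/[B8] word calculus
(`B7Prop1Explicit.hol`, `B8Lemma1NonAbelian.tw`): `permWord π v := tw [π(d−1), …, π(0)] v` walks the coordinates of
`v = x − q ≥ 0` in the order prescribed by the permutation `π` of the axes; `π = 1` is the tree contour `Γ_{q,x}` of
[2] (1.7) (`treeWord`, the lineage's `gammaT`, `permWord_one`); displacement `v` (`disp_permWord`), length `|v|₁`
(`length_permWord`), all letters forward; on an axis vector every `permWord` is the straight segment
(`permWord_zsmul_e`).  Forward words: bond-wise congruence `hol_congr_forward` and the walk estimate `forward_walk`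
(`|V(Γ) − 1| ≤ Σ_b |V_b − 1|` for `‖V_b‖ ≤ 1`).

§ 1c  PRINT'S «sets … with sufficiently small diameters» MADE A THEOREM for `𝐆(q, x)`: in the axial gauge at `q`
([B7] p. 24, `B7Prop1Explicit.axialFn`), `U(Γ^π)U(Γ^1)⁻¹ = V₀(Γ^π)` (`perm_mul_tree_inv_eq`), and by the sharp bond
identity of [B7] pp. 24–25 (`B8Lemma1NonAbelian.axial_bond_bound_sharp`, BY NAME) every bond of `Γ^π` satisfies
`|V₀,b − 1| ≤ |v|₁·ε₀` when the plaquettes of `[q, q + v]` are `ε₀`-regular, so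
`‖U(Γ^π_{q,x})U(Γ_{q,x})⁻¹ − 1‖ ≤ |v|₁²·ε₀` (`norm_perm_rel_sub_one_le`) `≤ (dL)²ε₀` on a block
(`norm_permT_mul_gammaT_inv_sub_one_le`).

§ 2  FEDERBUSH'S MEAN (0.10) ON `𝔸ˣ`-FAMILIES OF SMALL DIAMETER (not necessarily near `1`), by a base point: for
`F : ι → 𝔸ˣ` and `j₀`, the relative family `W_j = F_j F_{j₀}⁻¹` (`rel`), `X = fedSol W` (the tree's local solution of
(0.10), `BlockAveragingFederbush`, BY NAME) and `M(F) := X⁻¹ F_{j₀}` (`fedAvg`); PROVED: (0.10)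
`Σ_j log(F_j M⁻¹) = 0` (`sum_mlog_mul_fedAvg_inv`), constancy `M(S, …, S) = S` (`fedAvg_const`),
`‖M F_{j₀}⁻¹ − 1‖ ≤ 4δ`, `‖F_{j₀} M⁻¹ − 1‖ ≤ 3δ` for a `δ`-small relative family, `δ ≤ 1/100`; the two-sided (0.6)
`M({uF_jv}) = uM({F_j})v` for `u` in the closed-unit-ball group `U1` and any unit `v`, UNCONDITIONALLY
(`fedAvg_mul_mul`); (0.7) as re-indexing (`fedAvg_comp_equiv`) and as INDEPENDENCE OF THE BASE POINT on small
`U1`-valued families (`fedAvg_base_indep`, by the local uniqueness `fedSol_unique`).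

§ 3  THE AVERAGED CONTOUR VARIABLES (0.11) OF THE LINEAGE: `permT L U π x = U(Γ^π_{q,x})`, `q = L·⌊x/L⌋`
(`permT_one : permT L U 1 = gammaT L U`), and `𝐔(q, x) := M({U(Γ^π_{q,x})}_π)` based at the tree contour
(`Tavg`); PROVED block-local (`isBlockLocal_Tavg`, every `Γ^π_{q,x} ⊂ B(y)`) and axis-straight
(`isAxisStraightFamily_Tavg`: on an axis line `𝐆` is the single straight segment and `M` of a constant family is that
element) — the two family hypotheses of `B12AverageCorridor267` § 8; (0.10) for the contour family
(`sum_mlog_permT_Tavg`), `‖𝐔(q,x)U(Γ_{q,x})⁻¹ − 1‖ ≤ 4(dL)²ε₀`, independence of the base contour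
(`Tavg_eq_fedAvg`), gauge covariance of the word-level average (`fedAvg_perm_gaugeAct`, what (0.6) is for).

§ 4  THE (0.12) LOOPS OF THE AVERAGED VARIABLES: `W^avg_x = X(x)⁻¹ · W^tree_x · (U(c) X(x′) U(c)⁻¹)`
(`x′ = x + Le_μ`; `W^tree_x` = the [B7] (15) loop of `B12PlaquetteLoop267`), hence under plaquette regularity on
`B(c₋) ∪ B(c₊)` and `(dL)²ε₀ ≤ 1/100`: `‖W^avg_x − 1‖ ≤ ω_A(ε₀) := 10(dL)²ε₀` (`norm_loopW_Tavg_sub_one_le_local`,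
global form `norm_loopW_Tavg_sub_one_le`).

§ 5  THE `h`-PARAGRAPH OF P. 267 FOR THE AVERAGE (0.12) WITH THE AVERAGED CONTOUR VARIABLES (0.11):
`hAverage` := `B12AverageCorridor267.hGen` at `𝒯 = 𝐔`, and `h_paragraph_p267_average` :=
`B12AverageCorridor267.h_paragraph_p267_genuine` with both family hypotheses PROVED and the loop hypothesis
DISCHARGED from `‖U(∂p) − 1‖ ≤ ε₀` on `ℤᵈ`: (i) `LQ̃h = I`, (ii) uniqueness among corridor-supported right inverses,
(iii) the cell's bound; one sufficient numeric threshold `240·d²·L^{d+1}·ε₀ < 1` (`thresholds_avg_of_small`);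
NON-VACUITY at `U ≡ 1`, `ε₀ = 0` (`flat_average`).

SIBLING, NOT DUPLICATED.  The torus-side `BlockAveragingTwoLevel` (cell row T4-D.L2 (a)) types (0.11)/(0.12) as
DEFINITIONS over the axiomatic `Setup.GroupAverage` on a `GaugeGroup` (staircase walks of `T4Continuum`, covariance,
locality, lattice symmetries; no estimates; its census records (0.10) as not typed — needs `log`).  This leaf is the
`ℤᵈ`/Banach-units instance consumed by the p. 267 machinery of the lineage, with Federbush's (0.10) as the concrete
`M` (the tree's `FederbushMean.fedSol`) and the small-field ESTIMATES; nothing of the sibling is re-derived or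
imported (different site model).

DIVERGENCE FROM PRINT (cell `DIVERGENCE.md` row D-b12g23.1).  (a) CORNER cubes `B(y) = L·y + {0,…,L−1}ᵈ` with base
point `q = L·y` (lineage convention D-b12g20.1), not print's centred cubes `|n_μ| ≦ (L−1)/2` around `y`; all offsets
are `≥ 0`, all letters forward.  (b) The family is indexed by ALL `d!` orderings `π` of the axes; print's `𝐆(y,x)`
indexes by the orderings of the axes with `n_μ ≠ 0`, so each printed contour occurs `d!/|𝐆(y,x)|` times here — a
uniform repetition, under which the solution of (0.10) is unchanged (the equation is multiplied by a constant); cf.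
the sibling's D-pv11g5.1 (a).  (c) `M` is Federbush's (0.10) realised by the tree's LOCAL solution `fedSol` on
relative families with `‖W_j − 1‖ ≤ 1/100` (total extension by `1` off that domain), transported to families of small
diameter by the base point `j₀` (= the tree contour, `π = 1`); on `U1`-valued families of diameter `≤ 1/100` the
value does not depend on the base (`fedAvg_base_indep`) — this is the content of (0.7) for a family given as a SET.
(d) NOT TYPED: (0.5) `M({𝐔_j⁻¹}) = M({𝐔_j})⁻¹`, (0.8) (first-order agreement with the arithmetic mean of the
Lie-algebra elements), (0.9) (automatic by type only for `G = 𝔸ˣ`), analyticity of `M`, `Gᶜ`; the contour-PAIR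
average (0.4); the torus.  (e) Constants (`(dL)²ε₀`, `ω_A = 10(dL)²ε₀`, `240·d²·L^{d+1}·ε₀ < 1`) are the cell's
sufficient ones, print has «ε₀ positive and sufficiently small» and `O(1)`; `≤` for print's `<`.  (f) `𝐔(x′, c₊)` of
(0.12) is read as `𝐔(c₊, x′)⁻¹` (print's (0.5)), as in `B12AverageCorridor267.loopW`.
-/

noncomputable section

open NormedSpace Finset

namespace Literature.MathematicalPhysics.QuantumFieldTheory.Balaban1983to89.B12ContourAverage253

open Literature.MathematicalPhysics.QuantumLattice (ZdEdge blockMap blockBase blockSites mem_blockSites_iff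
  plaquetteHolonomyZd)
open B7Eq61Linearization (lineR)
open B7Prop1Explicit (Letter e seg seg_zero seg_natCast hol hol_nil hol_cons stepHol stepHol_true treeWord
  treeWord_zero disp disp_nil disp_cons disp_seg disp_append gaugeAct axialFn hol_gaugeAct U1 mem_U1 hol_mem
  gaugeAct_mem axialFn_mem norm_inv_sub_one_le norm_units_conj_sub_one_le norm_units_inv_conj_sub_one_le l1
  sum_zsmul_e boxVec l1_boxVec_le)
-- `PlaqSmall` is written qualified (the bare name resolves to the torus-side `Balaban1983to89.PlaqSmall`), and the
-- sites are written `Fin d → ℤ` (bare `Site` resolves to the torus sites of `Setup`).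
open B8Lemma1NonAbelian (tw tw_nil tw_cons treeWord_eq_tw zsmul_e_apply lowPart lowPart_nonneg lowPart_le_self
  e_nonneg pairTop boxVec_nonneg boxVec_le_pairTop boxVec_add_seg_le_pairTop axial_bond_bound_sharp
  disp_nonneg_of_forward flatMap_ite_eq omegaC omegaC_nonneg norm_triple_sub_one_le)
open B8Ineq170 (norm_mul_sub_one_le_of_norm_le_one)
open B12HOperator267 (gammaT CorridorSupported AxisStraight)
open B12AverageCorridor267 (Ustr IsBlockLocal IsAxisStraightFamily add_mem_blockSites_succ offAxis
  mem_blockSites_of_mem_offAxis loopW loopW_def LQ hGen h_paragraph_p267_genuine bounds_of_mem_blockSites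
  mem_blockSites_of_bounds)
open B12PlaquetteLoop267 (zsmul_e exists_boxVec hol_seg_eq_lineR gammaT_eq_hol_treeWord plaqSmall_curry
  loopW_gammaT_eq_Wcx norm_loopW_sub_one_le_local flat_regular)
open B13CorridorSeparation (b0Z)
open B13PkLocalTerms (hOp)
open FederbushMean (fed fed_def fedSol fedSol_spec fedSol_unique fedSol_of_not norm_fedSol_sub_one_le
  fedSol_const_one fedSol_comp_equiv fedSol_conj fed_fedSol sum_mlog_mul_fedSol)
open MatrixLog (mlog)

variable {d : ℕ}

/-! ## § 1  The contour family `𝐆(y,x)` of p. 252 as forward lattice words [folklore] -/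

section Family

/-- [cite: Balaban1987RG1, p.252] the contour of `𝐆(q, q + v)` labelled by the permutation `π` of the axes («take a
permutation {π(1), π(2), …} of indices μ …, next take |n_{π(1)}| bonds in the direction sign n_{π(1)}e_{π(1)} starting
at y, … and so on»): the coordinates of `v` walked in the order `π(d−1), π(d−2), …, π(0)` (b08's `tw` over the
permuted list of axes; `π = 1` is the tree contour `Γ_{q,q+v}` of [2] (1.7), `permWord_one`).  DIVERGENCE (b): all
`d!` orderings, including those of axes with `v_μ = 0` (empty segments). -/
def permWord (π : Equiv.Perm (Fin d)) (v : Fin d → ℤ) : List (Letter d) :=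
  tw (((List.finRange d).reverse).map π) v

/-- [folklore] `π = 1` gives the tree contour `Γ_{q, q+v}` (`treeWord`, axes `d−1, …, 0`). -/
theorem permWord_one (v : Fin d → ℤ) : permWord 1 v = treeWord v := by
  simp [permWord, treeWord_eq_tw]

/-- [folklore] the permuted list of axes has no duplicates … -/
theorem nodup_axes (π : Equiv.Perm (Fin d)) : (((List.finRange d).reverse).map π).Nodup :=
  List.Nodup.map π.injective (List.nodup_reverse.mpr (List.nodup_finRange d))

/-- [folklore] … and contains every axis. -/
theorem mem_axes (π : Equiv.Perm (Fin d)) (μ : Fin d) : μ ∈ ((List.finRange d).reverse).map π :=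
  List.mem_map.mpr ⟨π.symm μ, List.mem_reverse.mpr (List.mem_finRange _), π.apply_symm_apply μ⟩

/-- [folklore] displacement of a word over a list of axes. -/
theorem disp_tw (ks : List (Fin d)) (v : Fin d → ℤ) : disp (tw ks v) = (ks.map fun κ => v κ • e κ).sum := by
  induction ks with
  | nil => rw [tw_nil, disp_nil, List.map_nil, List.sum_nil]
  | cons κ ks ih => rw [tw_cons, disp_append, disp_seg, ih, List.map_cons, List.sum_cons]

/-- [cite: Balaban1987RG1, p.252] every contour of `𝐆(q, q+v)` ends at `q + v` («the final point at x»). -/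
theorem disp_permWord (π : Equiv.Perm (Fin d)) (v : Fin d → ℤ) : disp (permWord π v) = v := by
  rw [permWord, disp_tw, List.map_map, List.map_reverse, List.sum_reverse, ← Fin.sum_univ_def]
  calc ∑ κ, ((fun κ => v κ • e κ) ∘ π) κ = ∑ κ, v κ • e κ := Equiv.sum_comp π (fun κ => v κ • e κ)
    _ = v := sum_zsmul_e v

/-- [folklore] length of a word over a list of axes. -/
theorem length_tw (ks : List (Fin d)) (v : Fin d → ℤ) :
    (tw ks v).length = (ks.map fun κ => (v κ).natAbs).sum := by
  induction ks with
  | nil => rfl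
  | cons κ ks ih => rw [tw_cons, List.length_append, B7Prop1Explicit.length_seg, ih, List.map_cons, List.sum_cons]

/-- [cite: Balaban1987RG1, p.252] every contour of `𝐆(q, q+v)` has `|v|₁` bonds («shortest contours»). -/
theorem length_permWord (π : Equiv.Perm (Fin d)) (v : Fin d → ℤ) : (permWord π v).length = l1 v := by
  rw [permWord, length_tw, List.map_map, List.map_reverse, List.sum_reverse, ← Fin.sum_univ_def]
  exact Equiv.sum_comp π (fun κ => (v κ).natAbs)

/-- [folklore] letters of a word over axes of a non-negative vector are forward steps. -/
theorem forward_of_mem_tw {ks : List (Fin d)} {v : Fin d → ℤ} (hv : 0 ≤ v) {l : Letter d} (hl : l ∈ tw ks v) :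
    l = (l.1, true) := by
  rw [tw, List.mem_flatMap] at hl
  obtain ⟨κ, -, hκ⟩ := hl
  obtain ⟨n, hn⟩ := Int.eq_ofNat_of_zero_le (hv κ)
  rw [hn, seg_natCast, List.mem_replicate] at hκ
  rw [hκ.2]

/-- [folklore] DIVERGENCE (a): on corner cubes `v = x − q ≥ 0`, so every letter of every `Γ ∈ 𝐆(q,x)` is forward. -/
theorem forward_of_mem_permWord {π : Equiv.Perm (Fin d)} {v : Fin d → ℤ} (hv : 0 ≤ v) {l : Letter d}
    (hl : l ∈ permWord π v) : l = (l.1, true) :=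
  forward_of_mem_tw hv hl

/-- [folklore] a word over a duplicate-free list of axes containing `μ`, of the axis vector `n e_μ`, is the straight
segment. -/
theorem tw_zsmul_e {ks : List (Fin d)} (hks : ks.Nodup) {μ : Fin d} (hμ : μ ∈ ks) (n : ℤ) :
    tw ks (n • e μ) = seg μ n := by
  rw [tw]
  have : (fun κ : Fin d => seg κ ((n • e μ : Fin d → ℤ) κ)) = fun κ => if κ = μ then seg μ n else [] := by
    funext κ
    rw [zsmul_e_apply]
    split_ifs with h
    · rw [h]
    · rw [seg_zero]
  rw [this]
  exact flatMap_ite_eq μ (seg μ n) ks hks hμ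

/-- [cite: Balaban1987RG1, p.252] on an axis vector `n e_μ` the family `𝐆` consists of the straight segment alone
(«shortest contours»; here: every `permWord` IS that segment). -/
theorem permWord_zsmul_e (π : Equiv.Perm (Fin d)) (μ : Fin d) (n : ℤ) : permWord π (n • e μ) = seg μ n :=
  tw_zsmul_e (nodup_axes π) (mem_axes π μ) n

variable {G : Type*} [Group G]

/-- [folklore] LOCALITY OF FORWARD WORDS: the transporter along a forward word from `z` depends only on the bond
variables `V(p, p + e_κ)` with `z ≤ p`, `p + e_κ ≤ z + disp w`. -/
theorem hol_congr_forward {V V' : (Fin d → ℤ) → Fin d → G} :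
    ∀ (w : List (Letter d)) (z : Fin d → ℤ), (∀ l ∈ w, l = (l.1, true)) →
      (∀ (p : Fin d → ℤ) (κ : Fin d), z ≤ p → p + e κ ≤ z + disp w → V p κ = V' p κ) →
      hol V z w = hol V' z w
  | [], _, _, _ => by rw [hol_nil, hol_nil]
  | (μ, b) :: w, z, hfw, h => by
    obtain rfl : b = true := by simpa using hfw (μ, b) (by simp)
    have hw : ∀ l ∈ w, l = (l.1, true) := fun l hl => hfw l (List.mem_cons_of_mem _ hl)
    have hdw : (0 : Fin d → ℤ) ≤ disp w := disp_nonneg_of_forward hw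
    rw [hol_cons, hol_cons, stepHol_true, stepHol_true, B7Prop1Explicit.Letter.vec_true]
    congr 1
    · exact h z μ le_rfl (by
        rw [disp_cons, B7Prop1Explicit.Letter.vec_true, ← add_assoc]
        exact le_add_of_nonneg_right hdw)
    · exact hol_congr_forward w (z + e μ) hw fun p κ hp hp' =>
        h p κ ((le_add_of_nonneg_right (e_nonneg μ)).trans hp)
          (by rwa [disp_cons, B7Prop1Explicit.Letter.vec_true, ← add_assoc])

variable {𝔸 : Type*} [NormedRing 𝔸] [NormOneClass 𝔸]

/-- [folklore] the walk estimate for a FORWARD word (the bookkeeping behind [Balaban1985Averaging] pp. 24–25): if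
every bond of the word satisfies `‖W_b − 1‖ ≤ β` and all bond variables have norm `≤ 1`, then
`‖W(w) − 1‖ ≤ |w|·β`. -/
theorem forward_walk (W : (Fin d → ℤ) → Fin d → 𝔸ˣ) (hW : ∀ x κ, W x κ ∈ U1 𝔸) {β : ℝ} :
    ∀ (w : List (Letter d)) (z : Fin d → ℤ), (∀ l ∈ w, l = (l.1, true)) →
      (∀ (p : Fin d → ℤ) (κ : Fin d), z ≤ p → p + e κ ≤ z + disp w → ‖((W p κ : 𝔸ˣ) : 𝔸) - 1‖ ≤ β) →
      ‖((hol W z w : 𝔸ˣ) : 𝔸) - 1‖ ≤ w.length * β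
  | [], _, _, _ => by simp
  | (μ, b) :: w, z, hfw, h => by
    obtain rfl : b = true := by simpa using hfw (μ, b) (by simp)
    have hw : ∀ l ∈ w, l = (l.1, true) := fun l hl => hfw l (List.mem_cons_of_mem _ hl)
    have hdw : (0 : Fin d → ℤ) ≤ disp w := disp_nonneg_of_forward hw
    have hz : ‖((W z μ : 𝔸ˣ) : 𝔸) - 1‖ ≤ β :=
      h z μ le_rfl (by
        rw [disp_cons, B7Prop1Explicit.Letter.vec_true, ← add_assoc]
        exact le_add_of_nonneg_right hdw)
    have ih := forward_walk W hW w (z + e μ) hw fun p κ hp hp' =>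
      h p κ ((le_add_of_nonneg_right (e_nonneg μ)).trans hp)
        (by rwa [disp_cons, B7Prop1Explicit.Letter.vec_true, ← add_assoc])
    rw [hol_cons, stepHol_true, B7Prop1Explicit.Letter.vec_true, Units.val_mul, List.length_cons, Nat.cast_succ]
    calc ‖((W z μ : 𝔸ˣ) : 𝔸) * ((hol W (z + e μ) w : 𝔸ˣ) : 𝔸) - 1‖
        ≤ ‖((W z μ : 𝔸ˣ) : 𝔸) - 1‖ + ‖((hol W (z + e μ) w : 𝔸ˣ) : 𝔸) - 1‖ :=
          norm_mul_sub_one_le_of_norm_le_one (mem_U1.mp (hW z μ)).1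
      _ ≤ β + w.length * β := add_le_add hz ih
      _ = (w.length + 1 : ℝ) * β := by ring

/-! ### § 1c  Print's «sets … with sufficiently small diameters» for `𝐆(q,x)`, under plaquette regularity -/

omit [NormedRing 𝔸] [NormOneClass 𝔸] in
/-- [cite: Balaban1985Averaging, p.24] in the axial gauge `V₀ = V^{v₀}` based at `q` (`v₀(z) = V(Γ_{q,z})`), the
RELATIVE variable of two contours of `𝐆(q, q+v)` is a single transporter: `V(Γ^π)V(Γ^1)⁻¹ = V₀(Γ^π)`. -/
theorem perm_mul_tree_inv_eq (V : (Fin d → ℤ) → Fin d → G) (q v : Fin d → ℤ) (π : Equiv.Perm (Fin d)) :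
    hol V q (permWord π v) * (hol V q (treeWord v))⁻¹ = hol (gaugeAct (axialFn V q) V) q (permWord π v) := by
  rw [hol_gaugeAct, disp_permWord]
  simp [axialFn]

omit [NormedRing 𝔸] [NormOneClass 𝔸] in
/-- [folklore] `|·|₁` is monotone on the positive cone. -/
theorem l1_mono {u v : Fin d → ℤ} (hu : 0 ≤ u) (huv : u ≤ v) : l1 u ≤ l1 v := by
  show (∑ κ, (u κ).natAbs) ≤ ∑ κ, (v κ).natAbs
  exact Finset.sum_le_sum fun κ _ => by
    have h1 : 0 ≤ u κ := by simpa only [Pi.zero_apply] using hu κ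
    have h2 : u κ ≤ v κ := huv κ
    have e1 : ((u κ).natAbs : ℤ) = u κ := Int.natAbs_of_nonneg h1
    have e2 : ((v κ).natAbs : ℤ) = v κ := Int.natAbs_of_nonneg (h1.trans h2)
    rw [← Int.ofNat_le, e1, e2]
    exact h2

/-- [cite: Balaban1987RG1, p.253][cite: Balaban1985Averaging, pp.24–25] **THE FAMILY `{U(Γ)}_{Γ ∈ 𝐆(q,x)}` HAS SMALL
DIAMETER ON REGULAR CONFIGURATIONS**: for `v ≥ 0` and the plaquettes of `[lo, hi] ⊇ [q, q + v]` all `a`-regular,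
`‖V(Γ^π_{q,q+v})V(Γ_{q,q+v})⁻¹ − 1‖ ≤ |v|₁²·a` — each of the `|v|₁` bonds of `Γ^π` is within `|v|₁·a` of `1` in the
axial gauge at `q` (`B8Lemma1NonAbelian.axial_bond_bound_sharp`), and `forward_walk`. -/
theorem norm_perm_rel_sub_one_le (V : (Fin d → ℤ) → Fin d → 𝔸ˣ) (hV : ∀ x κ, V x κ ∈ U1 𝔸)
    {lo hi : Fin d → ℤ} {a : ℝ} (hP : B8Lemma1NonAbelian.PlaqSmall V lo hi a) (ha : 0 ≤ a)
    {q v : Fin d → ℤ} (hv : 0 ≤ v) (hlo : lo ≤ q) (hhi : q + v ≤ hi) (π : Equiv.Perm (Fin d)) :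
    ‖((hol V q (permWord π v) * (hol V q (treeWord v))⁻¹ : 𝔸ˣ) : 𝔸) - 1‖ ≤ (l1 v : ℝ) * ((l1 v : ℝ) * a) := by
  rw [perm_mul_tree_inv_eq]
  have h := forward_walk (gaugeAct (axialFn V q) V) (gaugeAct_mem hV (axialFn_mem hV q)) (β := (l1 v : ℝ) * a)
    (permWord π v) q (fun l hl => forward_of_mem_permWord hv hl) fun p κ hqp hpk => by
      rw [disp_permWord] at hpk
      have hpq0 : (0 : Fin d → ℤ) ≤ p - q := sub_nonneg.mpr hqp
      have hpqv : p - q ≤ v := fun i => by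
        have h1 : (p + e κ) i ≤ (q + v) i := hpk i
        have h2 : (0 : Fin d → ℤ) i ≤ e κ i := e_nonneg κ i
        simp only [Pi.add_apply, Pi.sub_apply, Pi.zero_apply] at h1 h2 ⊢; omega
      calc ‖((gaugeAct (axialFn V q) V p κ : 𝔸ˣ) : 𝔸) - 1‖ ≤ (l1 (lowPart κ (p - q)) : ℝ) * a :=
            axial_bond_bound_sharp V hV hP q p κ hlo hqp (hpk.trans hhi)
        _ ≤ (l1 v : ℝ) * a :=
            mul_le_mul_of_nonneg_right
              (Nat.cast_le.mpr (l1_mono (lowPart_nonneg κ hpq0) ((lowPart_le_self κ hpq0).trans hpqv))) ha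
  rwa [length_permWord] at h

end Family

/-! ## § 2  Federbush's mean (0.10) on families of units of small diameter, by a base point [folklore] -/

section Mean

variable {𝔸 : Type*} [NormedRing 𝔸] [NormedAlgebra ℂ 𝔸] [NormOneClass 𝔸] [CompleteSpace 𝔸]
variable {ι : Type*} [Fintype ι] [Nonempty ι]

/-- [folklore] the RELATIVE family `W_j = F_j F_{j₀}⁻¹` of a family of units seen from the base index `j₀` (print's
translation `𝐔_j = W_j 𝐔₀`, `BlockAveragingFederbush` § 2). -/
def rel (F : ι → 𝔸ˣ) (j₀ : ι) (j : ι) : 𝔸 := (F j : 𝔸) * (((F j₀)⁻¹ : 𝔸ˣ) : 𝔸)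

omit [NormedAlgebra ℂ 𝔸] [NormOneClass 𝔸] [CompleteSpace 𝔸] [Fintype ι] [Nonempty ι] in
/-- [folklore] the base member of the relative family is `1`. -/
@[simp] theorem rel_self (F : ι → 𝔸ˣ) (j₀ : ι) : rel F j₀ j₀ = 1 := by
  simp [rel]

omit [NormOneClass 𝔸] in
/-- [folklore] `fedSol W` is always within `3/100` of `1` (by `fedSol_spec` on the domain, `= 1` off it). -/
theorem norm_one_sub_fedSol_lt (W : ι → 𝔸) : ‖(1 : 𝔸) - fedSol W‖ < 1 := by
  by_cases h : ∀ j, ‖W j - 1‖ ≤ 1 / 100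
  · rw [norm_sub_rev]; exact (fedSol_spec h).1.trans_lt (by norm_num)
  · rw [fedSol_of_not h, sub_self, norm_zero]; exact one_pos

/-- [folklore] the tree's local solution `fedSol W` of (0.10) AS A UNIT of `𝔸` (Neumann series). -/
def fedUnit (W : ι → 𝔸) : 𝔸ˣ := Units.oneSub (1 - fedSol W) (norm_one_sub_fedSol_lt W)

omit [NormOneClass 𝔸] in
/-- [folklore] unfolding. -/
@[simp] theorem val_fedUnit (W : ι → 𝔸) : (fedUnit W : 𝔸) = fedSol W := by
  rw [fedUnit, Units.val_oneSub, sub_sub_cancel]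

omit [NormOneClass 𝔸] in
/-- [folklore] `fedUnit` depends on the family only through `fedSol`. -/
theorem fedUnit_congr {W W' : ι → 𝔸} (h : fedSol W = fedSol W') : fedUnit W = fedUnit W' :=
  Units.ext (by rw [val_fedUnit, val_fedUnit, h])

/-- [cite: Balaban1987RG1, (0.10) p.253] **FEDERBUSH'S MEAN OF A FAMILY OF UNITS**, by the base point `j₀`:
`M(F) := X⁻¹ F_{j₀}` where `X = fedSol (F_j F_{j₀}⁻¹)_j` solves `Σ_j log(F_j F_{j₀}⁻¹ X) = 0`, i.e. (0.10)
`Σ_j log(F_j M⁻¹) = 0` («The average of the set {𝐔_j} is the element 𝐔 ∈ Gᶜ such that 𝐔_j are in a small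
neighborhood of 𝐔, and it satisfies the equation Σ_{j=1}^n (1/i) log 𝐔_j𝐔⁻¹ = 0»).  Off the domain
`‖F_j F_{j₀}⁻¹ − 1‖ ≤ 1/100` the value is `F_{j₀}` (total extension).  DIVERGENCE (c). -/
def fedAvg (F : ι → 𝔸ˣ) (j₀ : ι) : 𝔸ˣ := (fedUnit (rel F j₀))⁻¹ * F j₀

omit [NormOneClass 𝔸] in
/-- [folklore] `M(F) F_{j₀}⁻¹ = X⁻¹`. -/
theorem fedAvg_mul_inv (F : ι → 𝔸ˣ) (j₀ : ι) : fedAvg F j₀ * (F j₀)⁻¹ = (fedUnit (rel F j₀))⁻¹ := by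
  rw [fedAvg, mul_inv_cancel_right]

omit [NormOneClass 𝔸] in
/-- [cite: Balaban1987RG1, (0.10) p.253] **(0.10) HOLDS**: `Σ_j log(F_j · M(F)⁻¹) = 0` on families of relative
diameter `≤ 1/100` (the tree's `FederbushMean.sum_mlog_mul_fedSol`, BY NAME). -/
theorem sum_mlog_mul_fedAvg_inv (F : ι → 𝔸ˣ) (j₀ : ι) (h : ∀ j, ‖rel F j₀ j - 1‖ ≤ 1 / 100) :
    ∑ j, mlog ((F j : 𝔸) * (((fedAvg F j₀)⁻¹ : 𝔸ˣ) : 𝔸)) = 0 := by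
  have hj : ∀ j, (F j : 𝔸) * (((fedAvg F j₀)⁻¹ : 𝔸ˣ) : 𝔸) = rel F j₀ j * fedSol (rel F j₀) := fun j => by
    simp only [fedAvg, mul_inv_rev, inv_inv, Units.val_mul, val_fedUnit, rel, mul_assoc]
  simp only [hj]
  exact sum_mlog_mul_fedSol h

omit [NormOneClass 𝔸] in
/-- [folklore] the mean of a constant family `{S, …, S}` is `S` (the relative family is `1`, `fedSol 1 = 1`). -/
theorem fedAvg_const (S : 𝔸ˣ) (j₀ : ι) : fedAvg (fun _ : ι => S) j₀ = S := by
  have hrel : rel (fun _ : ι => S) j₀ = fun _ => (1 : 𝔸) := funext fun _ => by simp [rel]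
  have hu : fedUnit (rel (fun _ : ι => S) j₀) = 1 :=
    Units.ext (by rw [val_fedUnit, hrel, fedSol_const_one, Units.val_one])
  rw [fedAvg, hu, inv_one, one_mul]

omit [NormOneClass 𝔸] in
/-- [folklore] the base element is `3δ`-close to the mean from the right: `‖F_{j₀} M(F)⁻¹ − 1‖ ≤ 3δ` for a
`δ`-small relative family, `δ ≤ 1/100` (`norm_fedSol_sub_one_le`). -/
theorem norm_base_mul_fedAvg_inv_sub_one_le {δ : ℝ} (hδ : δ ≤ 1 / 100) {F : ι → 𝔸ˣ} {j₀ : ι}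
    (h : ∀ j, ‖rel F j₀ j - 1‖ ≤ δ) : ‖((F j₀ * (fedAvg F j₀)⁻¹ : 𝔸ˣ) : 𝔸) - 1‖ ≤ 3 * δ := by
  rw [fedAvg, mul_inv_rev, inv_inv, mul_inv_cancel_left, val_fedUnit]
  exact norm_fedSol_sub_one_le hδ h

omit [NormOneClass 𝔸] in
/-- [folklore] **THE MEAN IS `4δ`-CLOSE TO THE BASE ELEMENT**: `‖M(F) F_{j₀}⁻¹ − 1‖ ≤ 4δ` for a `δ`-small relative
family, `δ ≤ 1/100` (`‖X − 1‖ ≤ 3δ` and the Neumann bound `‖X⁻¹ − 1‖ ≤ 3δ/(1 − 3δ) ≤ 4δ`). -/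
theorem norm_fedAvg_mul_inv_sub_one_le {δ : ℝ} (hδ : δ ≤ 1 / 100) {F : ι → 𝔸ˣ} {j₀ : ι}
    (h : ∀ j, ‖rel F j₀ j - 1‖ ≤ δ) : ‖((fedAvg F j₀ * (F j₀)⁻¹ : 𝔸ˣ) : 𝔸) - 1‖ ≤ 4 * δ := by
  have hδ0 : 0 ≤ δ := (norm_nonneg _).trans (h j₀)
  have hX : ‖fedSol (rel F j₀) - 1‖ ≤ 3 * δ := norm_fedSol_sub_one_le hδ h
  obtain ⟨-, hinv⟩ := FederbushMean.isUnit_and_norm_inverse_sub_one_le hX (by linarith)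
  have hval : (((fedUnit (rel F j₀))⁻¹ : 𝔸ˣ) : 𝔸) = Ring.inverse (fedSol (rel F j₀)) := by
    rw [← val_fedUnit, Ring.inverse_unit]
  rw [fedAvg_mul_inv, hval]
  refine hinv.trans ?_
  rw [div_le_iff₀ (by linarith)]
  nlinarith

omit [NormOneClass 𝔸] in
/-- [cite: Balaban1987RG1, (0.7) p.253] (0.7) AS RE-INDEXING: `M(F ∘ σ)` based at `j₀` is `M(F)` based at `σ j₀`
(`fedSol_comp_equiv`). -/
theorem fedAvg_comp_equiv (F : ι → 𝔸ˣ) (σ : Equiv.Perm ι) (j₀ : ι) (h : ∀ j, ‖rel F (σ j₀) j - 1‖ ≤ 1 / 100) :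
    fedAvg (F ∘ σ) j₀ = fedAvg F (σ j₀) := by
  have hr : rel (F ∘ σ) j₀ = rel F (σ j₀) ∘ σ := rfl
  rw [fedAvg, fedAvg, hr, fedUnit_congr (fedSol_comp_equiv h σ), Function.comp_apply]

omit [NormedAlgebra ℂ 𝔸] [CompleteSpace 𝔸] [Fintype ι] [Nonempty ι] in
/-- [folklore] conjugation by `u ∈ U1` is an ISOMETRY for `‖· − 1‖` (both `u` and `u⁻¹` contract). -/
theorem norm_units_conj_sub_one_eq {u : 𝔸ˣ} (hu : u ∈ U1 𝔸) (X : 𝔸) :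
    ‖(u : 𝔸) * X * ((u⁻¹ : 𝔸ˣ) : 𝔸) - 1‖ = ‖X - 1‖ := by
  refine le_antisymm (norm_units_conj_sub_one_le hu X) ?_
  have h := norm_units_inv_conj_sub_one_le hu ((u : 𝔸) * X * ((u⁻¹ : 𝔸ˣ) : 𝔸))
  rwa [show ((u⁻¹ : 𝔸ˣ) : 𝔸) * ((u : 𝔸) * X * ((u⁻¹ : 𝔸ˣ) : 𝔸)) * (u : 𝔸) = X by
    rw [← mul_assoc, ← mul_assoc, Units.inv_mul, one_mul, mul_assoc, Units.inv_mul, mul_one]] at h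

/-- [cite: Balaban1987RG1, (0.6) p.253] (0.6) for the solution of (0.10) under `U1`-conjugation, UNCONDITIONALLY (on
the domain by the tree's `fedSol_conj` with the isometry `norm_units_conj_sub_one_eq`; off it both sides are `1`). -/
theorem fedSol_units_conj {u : 𝔸ˣ} (hu : u ∈ U1 𝔸) (W : ι → 𝔸) :
    fedSol (fun j => (u : 𝔸) * W j * ((u⁻¹ : 𝔸ˣ) : 𝔸)) = (u : 𝔸) * fedSol W * ((u⁻¹ : 𝔸ˣ) : 𝔸) := by
  by_cases hW : ∀ j, ‖W j - 1‖ ≤ 1 / 100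
  · exact fedSol_conj (Units.mul_inv u) (Units.inv_mul u) (norm_units_conj_sub_one_eq hu) hW
  · have hW' : ¬ ∀ j, ‖(u : 𝔸) * W j * ((u⁻¹ : 𝔸ˣ) : 𝔸) - 1‖ ≤ 1 / 100 := by
      simpa only [norm_units_conj_sub_one_eq hu] using hW
    rw [fedSol_of_not hW, fedSol_of_not hW', mul_one, Units.mul_inv]

/-- [cite: Balaban1987RG1, (0.6) p.253] **(0.6), TWO-SIDED**: `M({u F_j v}) = u M({F_j}) v` for `u` in the
closed-unit-ball group `U1 𝔸` and every unit `v` (the relative family is conjugated by `u`; `v` cancels) — the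
covariance `𝐔^u(y,x) = u(y)𝐔(y,x)u(x)⁻¹` of the averaged contour variables (`fedAvg_perm_gaugeAct`). -/
theorem fedAvg_mul_mul {u : 𝔸ˣ} (hu : u ∈ U1 𝔸) (v : 𝔸ˣ) (F : ι → 𝔸ˣ) (j₀ : ι) :
    fedAvg (fun j => u * F j * v) j₀ = u * fedAvg F j₀ * v := by
  have hr : rel (fun j => u * F j * v) j₀ = fun j => (u : 𝔸) * rel F j₀ j * ((u⁻¹ : 𝔸ˣ) : 𝔸) := by
    funext j
    simp only [rel, mul_inv_rev, Units.val_mul, mul_assoc, Units.mul_inv_cancel_left]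
  have hunit : fedUnit (rel (fun j => u * F j * v) j₀) = u * fedUnit (rel F j₀) * u⁻¹ :=
    Units.ext (by rw [val_fedUnit, hr, fedSol_units_conj hu, Units.val_mul, Units.val_mul, val_fedUnit])
  rw [fedAvg, fedAvg, hunit]
  group

/-- [cite: Balaban1987RG1, (0.7) p.253] **(0.7) PROPER — INDEPENDENCE OF THE BASE POINT**: on a `U1`-valued family
of relative diameter `δ ≤ 1/100` (`‖F_i F_k⁻¹ − 1‖ ≤ δ` for all `i, k`) the mean does not depend on `j₀`: with
`g = F_{j₀} F_{j₁}⁻¹`, `g⁻¹ X` solves (0.10) for the family at `j₁` and lies in the uniqueness ball of the tree's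
`fedSol_unique`.  So `M` is a function of the SET `{F_j}` («invariant with respect to permutations of the contours»). -/
theorem fedAvg_base_indep {δ : ℝ} (hδ : δ ≤ 1 / 100) {F : ι → 𝔸ˣ} (hF : ∀ j, F j ∈ U1 𝔸)
    (h : ∀ i k, ‖rel F k i - 1‖ ≤ δ) (j₀ j₁ : ι) : fedAvg F j₀ = fedAvg F j₁ := by
  have hgU : F j₀ * (F j₁)⁻¹ ∈ U1 𝔸 := (U1 𝔸).mul_mem (hF j₀) ((U1 𝔸).inv_mem (hF j₁))
  have hW : ∀ j, ‖rel F j₀ j - 1‖ ≤ 1 / 100 := fun j => (h j j₀).trans hδ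
  have hW' : ∀ j, ‖rel F j₁ j - 1‖ ≤ 1 / 100 := fun j => (h j j₁).trans hδ
  have hrel : ∀ j, rel F j₁ j = rel F j₀ j * ((F j₀ * (F j₁)⁻¹ : 𝔸ˣ) : 𝔸) := fun j => by
    simp only [rel, Units.val_mul, mul_assoc, Units.inv_mul_cancel_left]
  have hg1 : ((F j₀ * (F j₁)⁻¹ : 𝔸ˣ) : 𝔸) = rel F j₁ j₀ := by simp only [rel, Units.val_mul]
  have hXn : ‖fedSol (rel F j₀) - 1‖ ≤ 3 * δ := norm_fedSol_sub_one_le hδ fun j => h j j₀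
  have hgn : ‖(((F j₀ * (F j₁)⁻¹)⁻¹ : 𝔸ˣ) : 𝔸) - 1‖ ≤ δ := by
    refine (norm_inv_sub_one_le hgU).trans ?_
    rw [hg1]
    exact h j₀ j₁
  have hδ0 : 0 ≤ δ := (norm_nonneg _).trans (h j₀ j₀)
  have hY : ‖(((F j₀ * (F j₁)⁻¹)⁻¹ : 𝔸ˣ) : 𝔸) * fedSol (rel F j₀) - 1‖ ≤ 2 / 25 :=
    calc ‖(((F j₀ * (F j₁)⁻¹)⁻¹ : 𝔸ˣ) : 𝔸) * fedSol (rel F j₀) - 1‖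
        ≤ ‖(((F j₀ * (F j₁)⁻¹)⁻¹ : 𝔸ˣ) : 𝔸) - 1‖ + ‖fedSol (rel F j₀) - 1‖ :=
          norm_mul_sub_one_le_of_norm_le_one (mem_U1.mp ((U1 𝔸).inv_mem hgU)).1
      _ ≤ δ + 3 * δ := add_le_add hgn hXn
      _ ≤ 2 / 25 := by linarith
  have hfed : fed (rel F j₁) ((((F j₀ * (F j₁)⁻¹)⁻¹ : 𝔸ˣ) : 𝔸) * fedSol (rel F j₀)) = 0 := by
    have hj : ∀ j, rel F j₁ j * ((((F j₀ * (F j₁)⁻¹)⁻¹ : 𝔸ˣ) : 𝔸) * fedSol (rel F j₀)) = rel F j₀ j * fedSol (rel F j₀) :=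
      fun j => by rw [hrel j, mul_assoc, Units.mul_inv_cancel_left]
    have h0 := fed_fedSol hW
    rw [fed_def] at h0 ⊢
    simpa only [hj] using h0
  have hsol : fedSol (rel F j₁) = (((F j₀ * (F j₁)⁻¹)⁻¹ : 𝔸ˣ) : 𝔸) * fedSol (rel F j₀) :=
    (fedSol_unique hW' hY hfed).symm
  have hunit : fedUnit (rel F j₁) = (F j₀ * (F j₁)⁻¹)⁻¹ * fedUnit (rel F j₀) :=
    Units.ext (by rw [val_fedUnit, hsol, Units.val_mul, val_fedUnit])
  rw [fedAvg, fedAvg, hunit]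
  group

end Mean

/-! ## § 3  The averaged contour variables (0.11) of the lineage -/

section Contours

variable {G : Type*} [Group G] (L : ℕ)

/-- [cite: Balaban1987RG1, (0.11) p.253][cite: Balaban1987RG1, p.252] `U(Γ^π_{q,x})`: the parallel transporter along
the contour of `𝐆(q, x)` labelled by `π`, from the base point `q = L·⌊x/L⌋` of the block of `x` (corner cubes,
DIVERGENCE (a)); `π = 1` is the lineage's `gammaT` (`permT_one`). -/
def permT (U : ZdEdge d → G) (π : Equiv.Perm (Fin d)) (x : Fin d → ℤ) : G :=
  hol (Function.curry U) (blockBase L (blockMap L x)) (permWord π (x - blockBase L (blockMap L x)))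

variable {L}

/-- [folklore] the contour `π = 1` of `𝐆(q,x)` is the tree contour: `permT L U 1 = gammaT L U`
(`B12PlaquetteLoop267.gammaT_eq_hol_treeWord`). -/
theorem permT_one (hL : 0 < L) (U : ZdEdge d → G) (x : Fin d → ℤ) : permT L U 1 x = gammaT L U x := by
  rw [permT, permWord_one, gammaT_eq_hol_treeWord hL]

/-- [folklore] `permT` on a site of the block `B(y)`, spelled from `L·y`. -/
theorem permT_eq_of_mem (hL : 0 < L) (U : ZdEdge d → G) {y x : Fin d → ℤ} (hx : x ∈ blockSites L y)
    (π : Equiv.Perm (Fin d)) :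
    permT L U π x = hol (Function.curry U) (blockBase L y) (permWord π (x - blockBase L y)) := by
  haveI : NeZero L := ⟨hL.ne'⟩
  rw [permT, (mem_blockSites_iff L y x).1 hx]

/-- [cite: Balaban1987RG1, p.252] **every contour of `𝐆(q,x)` lies in the block of `x`** («shortest contours with the
initial point at y, and the final point at x»): `U(Γ^π_{q,x})` depends only on the bonds inside `B(y)`. -/
theorem permT_congr (hL : 0 < L) {U U' : ZdEdge d → G} {y x : Fin d → ℤ} (hx : x ∈ blockSites L y)
    (hUU' : ∀ b : ZdEdge d, b.1 ∈ blockSites L y → b.1 + Pi.single b.2 1 ∈ blockSites L y → U b = U' b)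
    (π : Equiv.Perm (Fin d)) : permT L U π x = permT L U' π x := by
  have hbx := bounds_of_mem_blockSites hx
  have hv : (0 : Fin d → ℤ) ≤ x - blockBase L y := fun i => by
    have := (hbx i).1; simp only [Pi.zero_apply, Pi.sub_apply]; omega
  rw [permT_eq_of_mem hL U hx, permT_eq_of_mem hL U' hx]
  refine hol_congr_forward _ _ (fun l hl => forward_of_mem_permWord hv hl) fun p κ hqp hpk => ?_
  rw [disp_permWord, add_sub_cancel] at hpk
  have hpk' : ∀ i, p i + (Pi.single κ (1 : ℤ) : Fin d → ℤ) i ≤ x i := fun i => by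
    simpa only [Pi.add_apply, e] using hpk i
  have he : ∀ i, (0 : ℤ) ≤ (Pi.single κ (1 : ℤ) : Fin d → ℤ) i := fun i => by
    simpa only [Pi.zero_apply, e] using e_nonneg κ i
  refine hUU' (p, κ) (mem_blockSites_of_bounds hL fun i => ?_) (mem_blockSites_of_bounds hL fun i => ?_)
  · show blockBase L y i ≤ p i ∧ p i < blockBase L y i + L
    have h1 : blockBase L y i ≤ p i := hqp i
    have h2 := hbx i; have h3 := hpk' i; have h4 := he i
    constructor <;> omega
  · show blockBase L y i ≤ p i + (Pi.single κ (1 : ℤ) : Fin d → ℤ) i ∧ p i + (Pi.single κ (1 : ℤ) : Fin d → ℤ) i < blockBase L y i + L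
    have h1 : blockBase L y i ≤ p i := hqp i
    have h2 := hbx i; have h3 := hpk' i; have h4 := he i
    constructor <;> omega

/-- [folklore] the axis sites `L·y + t e_μ`, `t < L`, belong to `B(y)`. -/
theorem single_natCast_mem_blockSites (hL : 0 < L) (y : Fin d → ℤ) (μ : Fin d) {t : ℕ} (ht : t < L) :
    blockBase L y + Pi.single μ (t : ℤ) ∈ blockSites L y :=
  mem_blockSites_of_bounds hL fun i => by
    by_cases hi : i = μ
    · subst hi; simp only [Pi.add_apply, Pi.single_eq_same]; omega
    · simp only [Pi.add_apply, Pi.single_eq_of_ne hi, add_zero]; omega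

/-- [cite: Balaban1987RG1, p.252] on an axis line of the block every contour of `𝐆(q, q + t e_μ)` is the straight
segment, whose transporter is the lineage's `lineR` (`B12PlaquetteLoop267.hol_seg_eq_lineR`). -/
theorem permT_axis (hL : 0 < L) (U : ZdEdge d → G) (y : Fin d → ℤ) (μ : Fin d) {t : ℕ} (ht : t < L)
    (π : Equiv.Perm (Fin d)) :
    permT L U π (blockBase L y + Pi.single μ (t : ℤ)) = lineR U (blockBase L y) μ t := by
  rw [permT_eq_of_mem hL U (single_natCast_mem_blockSites hL y μ ht), add_sub_cancel_left, ← zsmul_e,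
    permWord_zsmul_e, hol_seg_eq_lineR]

end Contours

section Average

variable {𝔸 : Type*} [NormedRing 𝔸] [NormedAlgebra ℂ 𝔸] [NormOneClass 𝔸] [CompleteSpace 𝔸] (L : ℕ)

/-- [cite: Balaban1987RG1, (0.11) p.253] **THE AVERAGED CONTOUR VARIABLE `𝐔(q, x) = M({U(Γ)}_{Γ ∈ 𝐆(q,x)})`** of
the lineage: Federbush's mean (0.10) of the `d!` transporters `U(Γ^π_{q,x})`, based at the tree contour `π = 1`
(DIVERGENCE (a)–(c)); a block-local, axis-straight transporter family for `B12AverageCorridor267` § 8. -/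
def Tavg (U : ZdEdge d → 𝔸ˣ) (x : Fin d → ℤ) : 𝔸ˣ := fedAvg (fun π : Equiv.Perm (Fin d) => permT L U π x) 1

variable {L}

omit [NormOneClass 𝔸] in
/-- [folklore] unfolding: `𝐔(q,x) = X(x)⁻¹ · U(Γ_{q,x})` with `X(x) = fedSol (U(Γ^π_{q,x})U(Γ_{q,x})⁻¹)_π`. -/
theorem Tavg_eq (hL : 0 < L) (U : ZdEdge d → 𝔸ˣ) (x : Fin d → ℤ) :
    Tavg L U x = (fedUnit (rel (fun π : Equiv.Perm (Fin d) => permT L U π x) 1))⁻¹ * gammaT L U x := by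
  rw [Tavg, fedAvg, permT_one hL]

omit [NormOneClass 𝔸] in
/-- [cite: Balaban1987RG1, p.252] **`𝐔(q, ·)` IS A BLOCK-LOCAL FAMILY** (`B12AverageCorridor267.IsBlockLocal`): every
contour of `𝐆(q,x)` lies in `B(y)` (`permT_congr`). -/
theorem isBlockLocal_Tavg (hL : 0 < L) : IsBlockLocal L (fun U : ZdEdge d → 𝔸ˣ => Tavg L U) := by
  intro U U' y x hx hUU'
  show fedAvg (fun π : Equiv.Perm (Fin d) => permT L U π x) 1 = fedAvg (fun π => permT L U' π x) 1
  rw [show (fun π : Equiv.Perm (Fin d) => permT L U π x) = fun π => permT L U' π x from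
    funext fun π => permT_congr hL hx hUU' π]

omit [NormOneClass 𝔸] in
/-- [cite: Balaban1987RG1, p.252] on an axis line `𝐔(q, q + t e_μ)` is the straight transporter (one contour; the mean
of a constant family, `fedAvg_const`). -/
theorem Tavg_axis (hL : 0 < L) (U : ZdEdge d → 𝔸ˣ) (y : Fin d → ℤ) (μ : Fin d) {t : ℕ} (ht : t < L) :
    Tavg L U (blockBase L y + Pi.single μ (t : ℤ)) = lineR U (blockBase L y) μ t := by
  simp only [Tavg, permT_axis hL U y μ ht]
  exact fedAvg_const _ _

omit [NormOneClass 𝔸] in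
/-- [folklore] **`𝐔(q, ·)` IS AN AXIS-STRAIGHT FAMILY** (`B12AverageCorridor267.IsAxisStraightFamily`). -/
theorem isAxisStraightFamily_Tavg (hL : 0 < L) : IsAxisStraightFamily L (fun U : ZdEdge d → 𝔸ˣ => Tavg L U) :=
  fun U y μ _ ht => Tavg_axis hL U y μ ht

omit [NormedAlgebra ℂ 𝔸] [CompleteSpace 𝔸] in
/-- [cite: Balaban1987RG1, p.253][cite: Balaban1987RG1, p.254] **SMALL DIAMETER OF `{U(Γ)}_{Γ ∈ 𝐆(q,x)}` ON A
BLOCK**: for `x ∈ B(y)` and the plaquettes with corners in `[lo, hi] ⊇ [L·y, x]` all `ε₀`-regular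
(`‖U(∂p) − 1‖ ≤ ε₀`, `0 ≤ ε₀`) and `‖U(b)‖, ‖U(b)⁻¹‖ ≤ 1`: `‖U(Γ^π_{q,x})U(Γ_{q,x})⁻¹ − 1‖ ≤ (dL)²·ε₀` for every `π`
(`norm_perm_rel_sub_one_le` with `|x − q|₁ ≤ dL`). -/
theorem norm_permT_mul_gammaT_inv_sub_one_le (hL : 0 < L) (U : ZdEdge d → 𝔸ˣ)
    (hU : ∀ b, ‖((U b : 𝔸ˣ) : 𝔸)‖ ≤ 1) (hU' : ∀ b, ‖(((U b)⁻¹ : 𝔸ˣ) : 𝔸)‖ ≤ 1) {ε₀ : ℝ} (hε₀ : 0 ≤ ε₀)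
    {lo hi y x : Fin d → ℤ} (hx : x ∈ blockSites L y) (hlo : lo ≤ blockBase L y) (hhi : x ≤ hi)
    (hP : ∀ (p : Fin d → ℤ) (i j : Fin d), i ≠ j → lo ≤ p → p + Pi.single i 1 + Pi.single j 1 ≤ hi →
      ‖((plaquetteHolonomyZd U p i j : 𝔸ˣ) : 𝔸) - 1‖ ≤ ε₀)
    (π : Equiv.Perm (Fin d)) :
    ‖((permT L U π x * (gammaT L U x)⁻¹ : 𝔸ˣ) : 𝔸) - 1‖ ≤ ((d : ℝ) * L) ^ 2 * ε₀ := by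
  obtain ⟨r, hr⟩ := exists_boxVec hx
  haveI : NeZero L := ⟨hL.ne'⟩
  have hy : blockMap L x = y := (mem_blockSites_iff L y x).1 hx
  have hqx : blockBase L y + (x - blockBase L y) = x := by abel
  rw [permT_eq_of_mem hL U hx, gammaT_eq_hol_treeWord hL U x, hy]
  have h := norm_perm_rel_sub_one_le (Function.curry U) (fun _ _ => ⟨hU _, hU' _⟩) (plaqSmall_curry hP) hε₀
    (q := blockBase L y) (v := x - blockBase L y) (by rw [hr]; exact boxVec_nonneg L r) hlo
    (by rw [hqx]; exact hhi) π
  refine h.trans ?_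
  have hl1 : (l1 (x - blockBase L y) : ℝ) ≤ (d : ℝ) * L := by
    rw [hr]; exact_mod_cast l1_boxVec_le L r
  have hl0 : (0 : ℝ) ≤ l1 (x - blockBase L y) := Nat.cast_nonneg _
  have hdl : (0 : ℝ) ≤ (d : ℝ) * L := by positivity
  calc (l1 (x - blockBase L y) : ℝ) * ((l1 (x - blockBase L y) : ℝ) * ε₀)
      ≤ ((d : ℝ) * L) * (((d : ℝ) * L) * ε₀) :=
        mul_le_mul hl1 (mul_le_mul_of_nonneg_right hl1 hε₀) (mul_nonneg hl0 hε₀) hdl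
    _ = ((d : ℝ) * L) ^ 2 * ε₀ := by ring

omit [NormedAlgebra ℂ 𝔸] [CompleteSpace 𝔸] in
/-- [folklore] the relative family of `{U(Γ^π_{q,x})}_π` seen from the tree contour is `(dL)²ε₀`-small when the
plaquettes of the block `B(y) = [L·y, L·y + (L−1)·𝟙]` are `ε₀`-regular. -/
theorem rel_permT_small (hL : 0 < L) (U : ZdEdge d → 𝔸ˣ) (hU : ∀ b, ‖((U b : 𝔸ˣ) : 𝔸)‖ ≤ 1)
    (hU' : ∀ b, ‖(((U b)⁻¹ : 𝔸ˣ) : 𝔸)‖ ≤ 1) {ε₀ : ℝ} (hε₀ : 0 ≤ ε₀) {y x : Fin d → ℤ} (hx : x ∈ blockSites L y)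
    (hP : ∀ (p : Fin d → ℤ) (i j : Fin d), i ≠ j → blockBase L y ≤ p →
      p + Pi.single i 1 + Pi.single j 1 ≤ blockBase L y + (fun _ => (L : ℤ) - 1) →
      ‖((plaquetteHolonomyZd U p i j : 𝔸ˣ) : 𝔸) - 1‖ ≤ ε₀)
    (π : Equiv.Perm (Fin d)) :
    ‖rel (fun π : Equiv.Perm (Fin d) => permT L U π x) 1 π - 1‖ ≤ ((d : ℝ) * L) ^ 2 * ε₀ := by
  have hxhi : x ≤ blockBase L y + fun _ => (L : ℤ) - 1 := fun i => by
    have := (bounds_of_mem_blockSites hx i).2; simp only [Pi.add_apply]; omega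
  simp only [rel, permT_one hL, ← Units.val_mul]
  exact norm_permT_mul_gammaT_inv_sub_one_le hL U hU hU' hε₀ hx le_rfl hxhi hP π

/-- [cite: Balaban1987RG1, (0.10) p.253][cite: Balaban1987RG1, (0.11) p.253] **(0.10) FOR THE CONTOUR FAMILY**:
`Σ_{Γ ∈ 𝐆(q,x)} log(U(Γ) 𝐔(q,x)⁻¹) = 0` on `ε₀`-regular blocks with `(dL)²ε₀ ≤ 1/100`. -/
theorem sum_mlog_permT_Tavg (hL : 0 < L) (U : ZdEdge d → 𝔸ˣ) (hU : ∀ b, ‖((U b : 𝔸ˣ) : 𝔸)‖ ≤ 1)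
    (hU' : ∀ b, ‖(((U b)⁻¹ : 𝔸ˣ) : 𝔸)‖ ≤ 1) {ε₀ : ℝ} (hε₀ : 0 ≤ ε₀) (hsm : ((d : ℝ) * L) ^ 2 * ε₀ ≤ 1 / 100)
    {y x : Fin d → ℤ} (hx : x ∈ blockSites L y)
    (hP : ∀ (p : Fin d → ℤ) (i j : Fin d), i ≠ j → blockBase L y ≤ p →
      p + Pi.single i 1 + Pi.single j 1 ≤ blockBase L y + (fun _ => (L : ℤ) - 1) →
      ‖((plaquetteHolonomyZd U p i j : 𝔸ˣ) : 𝔸) - 1‖ ≤ ε₀) :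
    ∑ π : Equiv.Perm (Fin d), mlog (((permT L U π x : 𝔸ˣ) : 𝔸) * (((Tavg L U x)⁻¹ : 𝔸ˣ) : 𝔸)) = 0 :=
  sum_mlog_mul_fedAvg_inv _ 1 fun π => (rel_permT_small hL U hU hU' hε₀ hx hP π).trans hsm

/-- [cite: Balaban1987RG1, (0.11) p.253] **THE AVERAGED VARIABLE IS CLOSE TO THE TREE CONTOUR'S**:
`‖𝐔(q,x) U(Γ_{q,x})⁻¹ − 1‖ ≤ 4(dL)²ε₀` on `ε₀`-regular blocks with `(dL)²ε₀ ≤ 1/100`. -/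
theorem norm_Tavg_mul_gammaT_inv_sub_one_le (hL : 0 < L) (U : ZdEdge d → 𝔸ˣ)
    (hU : ∀ b, ‖((U b : 𝔸ˣ) : 𝔸)‖ ≤ 1) (hU' : ∀ b, ‖(((U b)⁻¹ : 𝔸ˣ) : 𝔸)‖ ≤ 1) {ε₀ : ℝ} (hε₀ : 0 ≤ ε₀)
    (hsm : ((d : ℝ) * L) ^ 2 * ε₀ ≤ 1 / 100) {y x : Fin d → ℤ} (hx : x ∈ blockSites L y)
    (hP : ∀ (p : Fin d → ℤ) (i j : Fin d), i ≠ j → blockBase L y ≤ p →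
      p + Pi.single i 1 + Pi.single j 1 ≤ blockBase L y + (fun _ => (L : ℤ) - 1) →
      ‖((plaquetteHolonomyZd U p i j : 𝔸ˣ) : 𝔸) - 1‖ ≤ ε₀) :
    ‖((Tavg L U x * (gammaT L U x)⁻¹ : 𝔸ˣ) : 𝔸) - 1‖ ≤ 4 * (((d : ℝ) * L) ^ 2 * ε₀) := by
  rw [← permT_one hL U x]
  exact norm_fedAvg_mul_inv_sub_one_le hsm (F := fun π : Equiv.Perm (Fin d) => permT L U π x) (j₀ := 1)
    fun π => rel_permT_small hL U hU hU' hε₀ hx hP π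

omit [NormedAlgebra ℂ 𝔸] [CompleteSpace 𝔸] in
/-- [folklore] contour transporters of a configuration with `‖U(b)‖, ‖U(b)⁻¹‖ ≤ 1` lie in `U1`. -/
theorem permT_mem_U1 (U : ZdEdge d → 𝔸ˣ) (hU : ∀ b, ‖((U b : 𝔸ˣ) : 𝔸)‖ ≤ 1)
    (hU' : ∀ b, ‖(((U b)⁻¹ : 𝔸ˣ) : 𝔸)‖ ≤ 1) (π : Equiv.Perm (Fin d)) (x : Fin d → ℤ) : permT L U π x ∈ U1 𝔸 :=
  hol_mem (fun _ _ => ⟨hU _, hU' _⟩) _ _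

/-- [cite: Balaban1987RG1, (0.7) p.253][cite: Balaban1987RG1, (0.11) p.253] **`𝐔(q,x)` DOES NOT DEPEND ON THE BASE
CONTOUR** («invariant with respect to permutations of the contours Γ in 𝐆(x, y)»): on `ε₀`-regular blocks with
`2(dL)²ε₀ ≤ 1/100`, Federbush's mean of `{U(Γ^π_{q,x})}_π` based at ANY `π₀` is `𝐔(q,x)` (`fedAvg_base_indep`; the
pairwise relative diameter is `≤ 2(dL)²ε₀`). -/
theorem Tavg_eq_fedAvg (hL : 0 < L) (U : ZdEdge d → 𝔸ˣ) (hU : ∀ b, ‖((U b : 𝔸ˣ) : 𝔸)‖ ≤ 1)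
    (hU' : ∀ b, ‖(((U b)⁻¹ : 𝔸ˣ) : 𝔸)‖ ≤ 1) {ε₀ : ℝ} (hε₀ : 0 ≤ ε₀)
    (hsm : 2 * (((d : ℝ) * L) ^ 2 * ε₀) ≤ 1 / 100) {y x : Fin d → ℤ} (hx : x ∈ blockSites L y)
    (hP : ∀ (p : Fin d → ℤ) (i j : Fin d), i ≠ j → blockBase L y ≤ p →
      p + Pi.single i 1 + Pi.single j 1 ≤ blockBase L y + (fun _ => (L : ℤ) - 1) →
      ‖((plaquetteHolonomyZd U p i j : 𝔸ˣ) : 𝔸) - 1‖ ≤ ε₀)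
    (π₀ : Equiv.Perm (Fin d)) :
    Tavg L U x = fedAvg (fun π : Equiv.Perm (Fin d) => permT L U π x) π₀ := by
  refine fedAvg_base_indep hsm (fun π => permT_mem_U1 U hU hU' π x) (fun i k => ?_) 1 π₀
  -- `F_i F_k⁻¹ = (F_i T⁻¹)(F_k T⁻¹)⁻¹`, both factors `(dL)²ε₀`-close to `1`
  have hT : gammaT L U x ∈ U1 𝔸 := by rw [← permT_one hL]; exact permT_mem_U1 U hU hU' 1 x
  have hi := rel_permT_small hL U hU hU' hε₀ hx hP i
  have hk := rel_permT_small hL U hU hU' hε₀ hx hP k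
  simp only [rel, permT_one hL, ← Units.val_mul] at hi hk ⊢
  have hiU : permT L U i x * (gammaT L U x)⁻¹ ∈ U1 𝔸 :=
    (U1 𝔸).mul_mem (permT_mem_U1 U hU hU' i x) ((U1 𝔸).inv_mem hT)
  have hkU : permT L U k x * (gammaT L U x)⁻¹ ∈ U1 𝔸 :=
    (U1 𝔸).mul_mem (permT_mem_U1 U hU hU' k x) ((U1 𝔸).inv_mem hT)
  have hid : permT L U i x * (permT L U k x)⁻¹ =
      (permT L U i x * (gammaT L U x)⁻¹) * (permT L U k x * (gammaT L U x)⁻¹)⁻¹ := by group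
  rw [hid, Units.val_mul]
  calc _ ≤ ‖((permT L U i x * (gammaT L U x)⁻¹ : 𝔸ˣ) : 𝔸) - 1‖
          + ‖(((permT L U k x * (gammaT L U x)⁻¹)⁻¹ : 𝔸ˣ) : 𝔸) - 1‖ :=
        norm_mul_sub_one_le_of_norm_le_one (mem_U1.mp hiU).1
    _ ≤ ((d : ℝ) * L) ^ 2 * ε₀ + ((d : ℝ) * L) ^ 2 * ε₀ := add_le_add hi ((norm_inv_sub_one_le hkU).trans hk)
    _ = 2 * (((d : ℝ) * L) ^ 2 * ε₀) := by ring

/-- [cite: Balaban1987RG1, (0.6) p.253][cite: Balaban1985Averaging, (8) p.18] **WHAT (0.6) IS FOR — GAUGE COVARIANCE OF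
THE AVERAGED CONTOUR VARIABLES**: for a gauge transformation `u` with `u(q) ∈ U1`, the mean of the transformed
contour variables `{V^u(Γ^π_{q,q+v})}_π = {u(q)V(Γ^π)u(q+v)⁻¹}_π` is `u(q) · M({V(Γ^π)}_π) · u(q+v)⁻¹`. -/
theorem fedAvg_perm_gaugeAct (V : (Fin d → ℤ) → Fin d → 𝔸ˣ) {u : (Fin d → ℤ) → 𝔸ˣ} (q v : Fin d → ℤ)
    (hu : u q ∈ U1 𝔸) :
    fedAvg (fun π : Equiv.Perm (Fin d) => hol (gaugeAct u V) q (permWord π v)) 1 =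
      u q * fedAvg (fun π : Equiv.Perm (Fin d) => hol V q (permWord π v)) 1 * (u (q + v))⁻¹ := by
  have : (fun π : Equiv.Perm (Fin d) => hol (gaugeAct u V) q (permWord π v)) =
      fun π => u q * hol V q (permWord π v) * (u (q + v))⁻¹ :=
    funext fun π => by rw [hol_gaugeAct, disp_permWord]
  rw [this]
  exact fedAvg_mul_mul hu _ _ 1

/-! ## § 4  The (0.12) loops of the averaged contour variables under plaquette regularity -/

/-- [folklore] the cell's loop constant for the (0.12) loops of `𝐔`: `ω_A(ε₀) := 10·(dL)²·ε₀`. -/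
def omegaA (d L : ℕ) (ε₀ : ℝ) : ℝ := 10 * ((d : ℝ) * L) ^ 2 * ε₀

omit [NormedRing 𝔸] [NormedAlgebra ℂ 𝔸] [NormOneClass 𝔸] [CompleteSpace 𝔸] in
/-- [folklore] `ω_A(ε₀) ≥ 0` for `ε₀ ≥ 0`. -/
theorem omegaA_nonneg (d L : ℕ) {ε₀ : ℝ} (hε₀ : 0 ≤ ε₀) : 0 ≤ omegaA d L ε₀ := by
  unfold omegaA; positivity

omit [NormedRing 𝔸] [NormedAlgebra ℂ 𝔸] [NormOneClass 𝔸] [CompleteSpace 𝔸] in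
/-- [folklore] the tree-contour loop constant `ω(ε₀) = L·ε₀·(d−1)(L−1)` of `B12PlaquetteLoop267` is `≤ (dL)²ε₀`. -/
theorem omegaC_le (hL : 0 < L) (hd : 1 ≤ d) {ε₀ : ℝ} (hε₀ : 0 ≤ ε₀) :
    omegaC d L ε₀ ≤ ((d : ℝ) * L) ^ 2 * ε₀ := by
  unfold omegaC
  have hL1 : (1 : ℝ) ≤ L := by exact_mod_cast hL
  have hd1 : (1 : ℝ) ≤ d := by exact_mod_cast hd
  have hA : ((d : ℝ) - 1) * ((L : ℝ) - 1) ≤ d * L := by nlinarith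
  have hB : (d : ℝ) * L ≤ d * (d * L) := by
    have : (0 : ℝ) ≤ (d : ℝ) * L := by positivity
    nlinarith
  have h' : ((d : ℝ) - 1) * ((L : ℝ) - 1) ≤ d * (d * L) := hA.trans hB
  calc (L : ℝ) * ε₀ * (((d : ℝ) - 1) * ((L : ℝ) - 1)) ≤ (L : ℝ) * ε₀ * (d * (d * L)) :=
        mul_le_mul_of_nonneg_left h' (by positivity)
    _ = ((d : ℝ) * L) ^ 2 * ε₀ := by ring

omit [NormedRing 𝔸] [NormedAlgebra ℂ 𝔸] [NormOneClass 𝔸] [CompleteSpace 𝔸] in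
/-- [folklore] the factorisation of the `𝐔`-loop through the tree loop: with `𝐔(x) = X⁻¹T`, `𝐔(x′) = X′⁻¹T′`,
`X⁻¹ T ℓ (X′⁻¹T′)⁻¹ S⁻¹ = X⁻¹ · (T ℓ T′⁻¹ S⁻¹) · (S X′ S⁻¹)`. -/
theorem loop_factor {G : Type*} [Group G] (X T ℓ X' T' S : G) :
    X⁻¹ * T * ℓ * (X'⁻¹ * T')⁻¹ * S⁻¹ = X⁻¹ * (T * ℓ * T'⁻¹ * S⁻¹) * (S * X' * S⁻¹) := by
  group

omit [NormedAlgebra ℂ 𝔸] [CompleteSpace 𝔸] in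
/-- [folklore] `‖P‖ ≤ 1 + ‖P − 1‖`. -/
theorem norm_le_one_add {P : 𝔸} {t : ℝ} (h : ‖P - 1‖ ≤ t) : ‖P‖ ≤ 1 + t :=
  calc ‖P‖ = ‖(P - 1) + 1‖ := by rw [sub_add_cancel]
    _ ≤ ‖P - 1‖ + ‖(1 : 𝔸)‖ := norm_add_le _ _
    _ ≤ t + 1 := by rw [norm_one]; linarith
    _ = 1 + t := by ring

/-- [cite: Balaban1987RG1, (0.12) p.254][cite: Balaban1987RG1, p.254] **THE (0.12) LOOPS OF THE AVERAGED CONTOUR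
VARIABLES ARE SMALL ON REGULAR CONFIGURATIONS, LOCAL FORM**: for `x ∈ B(c₋)`, `x′ = x + Le_μ`,
`W^avg_x(U) = 𝐔(c₋,x)U([x,x′])𝐔(c₊,x′)⁻¹U(c)⁻¹ = X(x)⁻¹ · W^tree_x(U) · (U(c)X(x′)U(c)⁻¹)` (`loop_factor`), so
`‖W^avg_x − 1‖ ≤ ω_A(ε₀) = 10(dL)²ε₀`, assuming `‖U(∂p) − 1‖ ≤ ε₀` only for the plaquettes with corners in
`B(c₋) ∪ B(c₊) = [L c₋, L c₋ + pairTop L μ]`, `(dL)²ε₀ ≤ 1/100`, and `‖U(b)‖, ‖U(b)⁻¹‖ ≤ 1` — from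
`‖X(x)⁻¹ − 1‖ ≤ 4(dL)²ε₀`, `‖X(x′) − 1‖ ≤ 3(dL)²ε₀` (§ 2 with `norm_permT_mul_gammaT_inv_sub_one_le`) and the tree-loop
bound `‖W^tree_x − 1‖ ≤ ω(ε₀) ≤ (dL)²ε₀` of `B12PlaquetteLoop267.norm_loopW_sub_one_le_local`. -/
theorem norm_loopW_Tavg_sub_one_le_local (hL : 0 < L) (hd : 1 ≤ d) (U : ZdEdge d → 𝔸ˣ)
    (hU : ∀ b, ‖((U b : 𝔸ˣ) : 𝔸)‖ ≤ 1) (hU' : ∀ b, ‖(((U b)⁻¹ : 𝔸ˣ) : 𝔸)‖ ≤ 1) {ε₀ : ℝ} (hε₀ : 0 ≤ ε₀)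
    (hsm : ((d : ℝ) * L) ^ 2 * ε₀ ≤ 1 / 100) (c : ZdEdge d)
    (h44 : ∀ (p : Fin d → ℤ) (i j : Fin d), i ≠ j → blockBase L c.1 ≤ p →
      p + Pi.single i 1 + Pi.single j 1 ≤ blockBase L c.1 + pairTop L c.2 →
      ‖((plaquetteHolonomyZd U p i j : 𝔸ˣ) : 𝔸) - 1‖ ≤ ε₀)
    {x : Fin d → ℤ} (hx : x ∈ blockSites L c.1) :
    ‖((loopW L (fun U : ZdEdge d → 𝔸ˣ => Tavg L U) U c x : 𝔸ˣ) : 𝔸) - 1‖ ≤ omegaA d L ε₀ := by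
  have hδ0 : 0 ≤ ((d : ℝ) * L) ^ 2 * ε₀ := by positivity
  -- geometry of the two blocks
  have hx' : x + Pi.single c.2 (L : ℤ) ∈ blockSites L (c.1 + Pi.single c.2 1) := add_mem_blockSites_succ hL c.2 hx
  obtain ⟨r, hr⟩ := exists_boxVec hx
  have hxhi : x ≤ blockBase L c.1 + pairTop L c.2 := fun i => by
    have h := boxVec_le_pairTop L c.2 r i
    rw [← hr] at h; simp only [Pi.sub_apply, Pi.add_apply] at h ⊢; linarith
  have hx'hi : x + Pi.single c.2 (L : ℤ) ≤ blockBase L c.1 + pairTop L c.2 := fun i => by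
    have h := boxVec_add_seg_le_pairTop L c.2 r i
    rw [← hr, zsmul_e] at h; simp only [Pi.sub_apply, Pi.add_apply] at h ⊢; linarith
  have hq' : blockBase L c.1 ≤ blockBase L (c.1 + Pi.single c.2 1) := fun i => by
    rw [B12AverageCorridor267.blockBase_add_single]
    by_cases hi : i = c.2
    · subst hi; simp only [Pi.add_apply, Pi.single_eq_same]; omega
    · simp only [Pi.add_apply, Pi.single_eq_of_ne hi, add_zero]; exact le_rfl
  -- the two relative families are `(dL)²ε₀`-small
  have hR : ∀ π, ‖rel (fun π : Equiv.Perm (Fin d) => permT L U π x) 1 π - 1‖ ≤ ((d : ℝ) * L) ^ 2 * ε₀ :=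
    fun π => by
      simp only [rel, permT_one hL, ← Units.val_mul]
      exact norm_permT_mul_gammaT_inv_sub_one_le hL U hU hU' hε₀ hx le_rfl hxhi h44 π
  have hR' : ∀ π, ‖rel (fun π : Equiv.Perm (Fin d) => permT L U π (x + Pi.single c.2 (L : ℤ))) 1 π - 1‖
      ≤ ((d : ℝ) * L) ^ 2 * ε₀ := fun π => by
      simp only [rel, permT_one hL, ← Units.val_mul]
      exact norm_permT_mul_gammaT_inv_sub_one_le hL U hU hU' hε₀ hx' hq' hx'hi h44 π
  -- the factors
  have hUc : ∀ z κ, Function.curry U z κ ∈ U1 𝔸 := fun _ _ => ⟨hU _, hU' _⟩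
  have hS : Ustr L U c ∈ U1 𝔸 := by
    rw [Ustr, ← hol_seg_eq_lineR]; exact hol_mem hUc _ _
  have hWt : ‖((loopW L (fun U : ZdEdge d → 𝔸ˣ => gammaT L U) U c x : 𝔸ˣ) : 𝔸) - 1‖ ≤ ((d : ℝ) * L) ^ 2 * ε₀ :=
    (norm_loopW_sub_one_le_local hL U hU hU' hε₀ c h44 hx).trans (omegaC_le hL hd hε₀)
  have hP : ‖((((fedUnit (rel (fun π : Equiv.Perm (Fin d) => permT L U π x) 1))⁻¹ : 𝔸ˣ)) : 𝔸) - 1‖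
      ≤ 4 * (((d : ℝ) * L) ^ 2 * ε₀) := by
    rw [← fedAvg_mul_inv]; exact norm_fedAvg_mul_inv_sub_one_le hsm hR
  have hQ : ‖((Ustr L U c * fedUnit (rel (fun π : Equiv.Perm (Fin d) => permT L U π (x + Pi.single c.2 (L : ℤ))) 1)
      * (Ustr L U c)⁻¹ : 𝔸ˣ) : 𝔸) - 1‖ ≤ 3 * (((d : ℝ) * L) ^ 2 * ε₀) := by
    rw [Units.val_mul, Units.val_mul]
    refine (norm_units_conj_sub_one_le hS _).trans ?_
    rw [val_fedUnit]
    exact norm_fedSol_sub_one_le hsm hR'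
  have hfac : loopW L (fun U : ZdEdge d → 𝔸ˣ => Tavg L U) U c x =
      (fedUnit (rel (fun π : Equiv.Perm (Fin d) => permT L U π x) 1))⁻¹
        * loopW L (fun U : ZdEdge d → 𝔸ˣ => gammaT L U) U c x
        * (Ustr L U c * fedUnit (rel (fun π : Equiv.Perm (Fin d) => permT L U π (x + Pi.single c.2 (L : ℤ))) 1)
            * (Ustr L U c)⁻¹) := by
    rw [loopW_def, loopW_def, Tavg_eq hL, Tavg_eq hL]
    exact loop_factor _ _ _ _ _ _
  rw [hfac, Units.val_mul, Units.val_mul]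
  refine (norm_triple_sub_one_le _ _ _).trans ?_
  -- bookkeeping of the three factors
  set δ : ℝ := ((d : ℝ) * L) ^ 2 * ε₀ with hδ
  set P : 𝔸 := ((((fedUnit (rel (fun π : Equiv.Perm (Fin d) => permT L U π x) 1))⁻¹ : 𝔸ˣ)) : 𝔸) with hPdef
  set Z : 𝔸 := ((loopW L (fun U : ZdEdge d → 𝔸ˣ => gammaT L U) U c x : 𝔸ˣ) : 𝔸) with hZdef
  set Q : 𝔸 := ((Ustr L U c * fedUnit (rel (fun π : Equiv.Perm (Fin d) => permT L U π (x + Pi.single c.2 (L : ℤ))) 1)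
      * (Ustr L U c)⁻¹ : 𝔸ˣ) : 𝔸) with hQdef
  have hPn : ‖P‖ ≤ 1 + 4 * δ := norm_le_one_add hP
  have hQn : ‖Q‖ ≤ 1 + 3 * δ := norm_le_one_add hQ
  have h14 : 0 ≤ 1 + 4 * δ := by linarith
  have t1 : ‖P‖ * ‖Z - 1‖ * ‖Q‖ ≤ (1 + 4 * δ) * δ * (1 + 3 * δ) :=
    mul_le_mul (mul_le_mul hPn hWt (norm_nonneg _) h14) hQn (norm_nonneg _) (mul_nonneg h14 hδ0)
  have t2 : ‖P - 1‖ * ‖Q‖ ≤ 4 * δ * (1 + 3 * δ) := mul_le_mul hP hQn (norm_nonneg _) (by linarith)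
  have hδ1 : δ ≤ 1 / 100 := hsm
  have key : (1 + 4 * δ) * δ * (1 + 3 * δ) + 4 * δ * (1 + 3 * δ) + 3 * δ ≤ 10 * δ := by
    nlinarith [mul_nonneg hδ0 (by linarith : (0 : ℝ) ≤ 1 / 100 - δ),
      mul_nonneg (mul_nonneg hδ0 hδ0) (by linarith : (0 : ℝ) ≤ 1 / 100 - δ)]
  have hω : omegaA d L ε₀ = 10 * δ := by rw [omegaA, hδ]; ring
  rw [hω]
  linarith

/-- [cite: Balaban1987RG1, (0.12) p.254][cite: Balaban1987RG1, p.254] **GLOBAL FORM**: under print's regularity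
`‖U(∂p) − 1‖ ≤ ε₀` for all plaquettes of `ℤᵈ` («for p ∈ T»), `‖U(b)‖, ‖U(b)⁻¹‖ ≤ 1` and `(dL)²ε₀ ≤ 1/100`, every
off-axis (0.12) loop of the averaged contour variables satisfies `‖W^avg_x(U) − 1‖ ≤ ω_A(ε₀)` — the hypothesis `hW` of
`B12AverageCorridor267.h_paragraph_p267_genuine` for `𝒯 = 𝐔`. -/
theorem norm_loopW_Tavg_sub_one_le (hL : 0 < L) (hd : 1 ≤ d) (U : ZdEdge d → 𝔸ˣ)
    (hU : ∀ b, ‖((U b : 𝔸ˣ) : 𝔸)‖ ≤ 1) (hU' : ∀ b, ‖(((U b)⁻¹ : 𝔸ˣ) : 𝔸)‖ ≤ 1) {ε₀ : ℝ} (hε₀ : 0 ≤ ε₀)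
    (hsm : ((d : ℝ) * L) ^ 2 * ε₀ ≤ 1 / 100)
    (h44 : ∀ (p : Fin d → ℤ) (i j : Fin d), i ≠ j → ‖((plaquetteHolonomyZd U p i j : 𝔸ˣ) : 𝔸) - 1‖ ≤ ε₀) :
    ∀ c, ∀ x ∈ offAxis L c,
      ‖((loopW L (fun U : ZdEdge d → 𝔸ˣ => Tavg L U) U c x : 𝔸ˣ) : 𝔸) - 1‖ ≤ omegaA d L ε₀ :=
  fun c _ hx => norm_loopW_Tavg_sub_one_le_local hL hd U hU hU' hε₀ hsm c (fun p i j hij _ _ => h44 p i j hij)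
    (mem_blockSites_of_mem_offAxis hx)

/-! ## § 5  The `h`-paragraph of [B12] p. 267 for the average (0.12) with the averaged contour variables (0.11) -/

omit [NormedRing 𝔸] [NormedAlgebra ℂ 𝔸] [NormOneClass 𝔸] [CompleteSpace 𝔸] in
/-- [folklore] «ε₀ positive and sufficiently small», made explicit: `240·d²·L^{d+1}·ε₀ < 1` implies the three
thresholds used below, `(dL)²ε₀ ≤ 1/100`, `ω_A(ε₀) ≤ 1/8`, `(Lᵈ/L)·24·ω_A(ε₀) < 1`
(`(Lᵈ/L)·24·ω_A(ε₀) = 240·d²·L^{d+1}·ε₀`). -/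
theorem thresholds_avg_of_small (hL : 0 < L) (hd : 1 ≤ d) {ε₀ : ℝ} (hε₀ : 0 ≤ ε₀)
    (h : 240 * (d : ℝ) ^ 2 * (L : ℝ) ^ (d + 1) * ε₀ < 1) :
    ((d : ℝ) * L) ^ 2 * ε₀ ≤ 1 / 100 ∧ omegaA d L ε₀ ≤ 1 / 8 ∧ (L : ℝ) ^ d / L * (24 * omegaA d L ε₀) < 1 := by
  have hL1 : (1 : ℝ) ≤ L := by exact_mod_cast hL
  have hL0 : (0 : ℝ) < L := by positivity
  have h2 : (L : ℝ) ^ 2 ≤ (L : ℝ) ^ (d + 1) := pow_le_pow_right₀ hL1 (by omega)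
  have hδ : ((d : ℝ) * L) ^ 2 * ε₀ ≤ (d : ℝ) ^ 2 * (L : ℝ) ^ (d + 1) * ε₀ := by
    rw [mul_pow]
    exact mul_le_mul_of_nonneg_right (mul_le_mul_of_nonneg_left h2 (by positivity)) hε₀
  have key : (L : ℝ) ^ d / L * (24 * omegaA d L ε₀) = 240 * (d : ℝ) ^ 2 * (L : ℝ) ^ (d + 1) * ε₀ := by
    unfold omegaA
    field_simp
    ring
  refine ⟨by linarith, ?_, by rw [key]; exact h⟩
  unfold omegaA
  linarith

/-- [cite: Balaban1987RG1, p.267][cite: Balaban1987RG1, (0.12) p.254][cite: Balaban1987RG1, (0.11) p.253] **THE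
OPERATOR `h` OF P. 267 FOR THE AVERAGE (0.12) BUILT FROM THE AVERAGED CONTOUR VARIABLES (0.11)** on the regular
configurations of p. 254: the fibre maps of `B12AverageCorridor267.hGen` at `𝒯 = 𝐔` (Neumann series around the main
term `L^{1−d}Ad_{g(c)}`), the loop-level small field SUPPLIED by `norm_loopW_Tavg_sub_one_le`. -/
def hAverage (hL : 0 < L) (hd : 1 ≤ d) (U : ZdEdge d → 𝔸ˣ) (hU : ∀ b, ‖((U b : 𝔸ˣ) : 𝔸)‖ ≤ 1)
    (hU' : ∀ b, ‖(((U b)⁻¹ : 𝔸ˣ) : 𝔸)‖ ≤ 1) {ε₀ : ℝ} (hε₀ : 0 ≤ ε₀)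
    (h44 : ∀ (p : Fin d → ℤ) (i j : Fin d), i ≠ j → ‖((plaquetteHolonomyZd U p i j : 𝔸ˣ) : 𝔸) - 1‖ ≤ ε₀)
    (hsm : ((d : ℝ) * L) ^ 2 * ε₀ ≤ 1 / 100) (hω : omegaA d L ε₀ ≤ 1 / 8)
    (hbud : (L : ℝ) ^ d / L * (24 * omegaA d L ε₀) < 1) (c : ZdEdge d) : 𝔸 →L[ℝ] 𝔸 :=
  hGen hL (isAxisStraightFamily_Tavg hL) U (omegaA_nonneg d L hε₀) hω
    (norm_loopW_Tavg_sub_one_le hL hd U hU hU' hε₀ hsm h44) hU hU' hbud c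

/-- [cite: Balaban1987RG1, p.267][cite: Balaban1987RG1, (0.12) p.254][cite: Balaban1987RG1, (0.11) p.253] **THE
`h`-PARAGRAPH OF P. 267 FOR PRINT'S EUCLIDEAN-INVARIANT AVERAGE (0.12) WITH THE AVERAGED CONTOUR VARIABLES (0.11),
ON REGULAR CONFIGURATIONS** — the two printed clauses (i), (ii) and the cell's bound (iii) (p. 267 prints no norm
bound on `h`) for the genuine linearization `𝒬 = LQ̃_U` of (2.4) with the transporter family `𝐔`:
(i) «LQ̃h = I»: `LQ̃_U (h B) = B` for the corridor-supported `h = hOp b₀ hAverage`;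
(ii) «h is uniquely defined»: every corridor-supported right inverse of `LQ̃_U` is this `h`;
(iii) `‖h(c)X‖ ≤ (Lᵈ/L)/(1 − (Lᵈ/L)·24ω_A(ε₀))·‖X‖`;
under `‖U(∂p) − 1‖ ≤ ε₀` for all plaquettes of `ℤᵈ`, `0 ≤ ε₀`, `(dL)²ε₀ ≤ 1/100`, `ω_A(ε₀) ≤ 1/8`,
`(Lᵈ/L)·24ω_A(ε₀) < 1` (`d ≥ 1`; e.g. `240·d²·L^{d+1}·ε₀ < 1`, `thresholds_avg_of_small`), plus `‖U(b)‖, ‖U(b)⁻¹‖ ≤ 1`.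
(= `B12AverageCorridor267.h_paragraph_p267_genuine` with BOTH family hypotheses PROVED — `isBlockLocal_Tavg`,
`isAxisStraightFamily_Tavg` — and `hW` DISCHARGED by `norm_loopW_Tavg_sub_one_le`.) -/
theorem h_paragraph_p267_average (hL : 0 < L) (hd : 1 ≤ d) (U : ZdEdge d → 𝔸ˣ)
    (hU : ∀ b, ‖((U b : 𝔸ˣ) : 𝔸)‖ ≤ 1) (hU' : ∀ b, ‖(((U b)⁻¹ : 𝔸ˣ) : 𝔸)‖ ≤ 1) {ε₀ : ℝ} (hε₀ : 0 ≤ ε₀)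
    (h44 : ∀ (p : Fin d → ℤ) (i j : Fin d), i ≠ j → ‖((plaquetteHolonomyZd U p i j : 𝔸ˣ) : 𝔸) - 1‖ ≤ ε₀)
    (hsm : ((d : ℝ) * L) ^ 2 * ε₀ ≤ 1 / 100) (hω : omegaA d L ε₀ ≤ 1 / 8)
    (hbud : (L : ℝ) ^ d / L * (24 * omegaA d L ε₀) < 1) :
    (∀ B c, LQ L (fun U : ZdEdge d → 𝔸ˣ => Tavg L U) U
        (hOp (b0Z L) (fun c X => hAverage hL hd U hU hU' hε₀ h44 hsm hω hbud c X) B) c = B c) ∧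
    (∀ 𝒽 : (ZdEdge d → 𝔸) → ZdEdge d → 𝔸, CorridorSupported L 𝒽 →
        (∀ B c, LQ L (fun U : ZdEdge d → 𝔸ˣ => Tavg L U) U (𝒽 B) c = B c) →
        𝒽 = hOp (b0Z L) (fun c X => hAverage hL hd U hU hU' hε₀ h44 hsm hω hbud c X)) ∧
    (∀ c X, ‖hAverage hL hd U hU hU' hε₀ h44 hsm hω hbud c X‖
        ≤ ((L : ℝ) ^ d / L) / (1 - (L : ℝ) ^ d / L * (24 * omegaA d L ε₀)) * ‖X‖) :=
  h_paragraph_p267_genuine hL (isBlockLocal_Tavg hL) (isAxisStraightFamily_Tavg hL) U (omegaA_nonneg d L hε₀) hω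
    (norm_loopW_Tavg_sub_one_le hL hd U hU hU' hε₀ hsm h44) hU hU' hbud

omit [NormedAlgebra ℂ 𝔸] [CompleteSpace 𝔸] in
/-- [folklore] **NON-VACUITY**: at the flat configuration `U ≡ 1` (every `d`, every `L`) all hypotheses of
`h_paragraph_p267_average` hold with `ε₀ = 0` (`B12PlaquetteLoop267.flat_regular` and `ω_A(0) = 0`). -/
theorem flat_average (L : ℕ) :
    (∀ b, ‖(((1 : ZdEdge d → 𝔸ˣ) b : 𝔸ˣ) : 𝔸)‖ ≤ 1) ∧
    (∀ b, ‖((((1 : ZdEdge d → 𝔸ˣ) b)⁻¹ : 𝔸ˣ) : 𝔸)‖ ≤ 1) ∧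
    (∀ (p : Fin d → ℤ) (i j : Fin d), i ≠ j →
        ‖((plaquetteHolonomyZd (1 : ZdEdge d → 𝔸ˣ) p i j : 𝔸ˣ) : 𝔸) - 1‖ ≤ (0 : ℝ)) ∧
    ((d : ℝ) * L) ^ 2 * 0 ≤ 1 / 100 ∧ omegaA d L 0 ≤ 1 / 8 ∧ (L : ℝ) ^ d / L * (24 * omegaA d L 0) < 1 := by
  obtain ⟨h1, h2, h3, -, -⟩ := flat_regular (𝔸 := 𝔸) (d := d) L
  exact ⟨h1, h2, h3, by norm_num, by simp [omegaA], by simp [omegaA]⟩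

end Average

end Literature.MathematicalPhysics.QuantumFieldTheory.Balaban1983to89.B12ContourAverage253

end
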